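import Mathlib
import HarnessLib
import Summits.NavierStokesRegularity.NavierStokesRegularity.Theorems.UnthreadedRigidityDoorUnthreadedRigidityProfileHornDefs

/-!
# Route `UnthreadedRigidityDoor`, item `UnthreadedRigidity` (W2, stmt-NavierStokesRegularity-27585) — LINE g10-2 «PROFILE HORN»,
# BRIDGE PH (L-part `ThreadingJets.HornSliceIdentityTwo`): THE OBJECTS OF THE `l = 2` MULTIPOLE PRESSURE

Definition file (W2 Lean hand ns-crc-p1 g9, by lineage; `--supports stmt-NavierStokesRegularity-27585 --as helper`).  Bridge PH of the
PROFILE HORN line (`ProfileHorn.HornIdentityTwo`, p689891) is L-only since p704808 (`ThreadingJets.hornIdentityTwo_of_slice`): it needs the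
slice identity `ThreadingJets.HornSliceIdentityTwo` (p704398), and after crc-p2 g8's `VirialHorn.fluxJetTwo_sepShell_eq` (p709038) exactly ONE
thing is missing — the `l = 2` PRESSURE BRACKET `{Y_Q, z·∇p₀}(z) = D_Q(z)·(4e₂(|z|) − (16/7)|z|² e₄(|z|))` for the DECAYING solution `p₀` of the
slice Poisson equation `Δp₀ = −div((u₀·∇)u₀)`, `u₀ = sepShell H Q x₀`.  This file names the explicit objects of that computation; the proofs
(source identity, radial layer, the explicit pressure and its uniqueness, the bracket) follow in `…HornPressure{Source,Radial,Field,Bracket}.lean`.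

Objects (all in the variable `s = |z|²`, the profile being `H(r) = h(r²)` with `h` smooth, as in `HornAdmissible`):
* `matCLM M` — the linear map of a `3 × 3` matrix on `E3`; `shellDeriv M z g A A′ B B′ Y` — the derivative of an explicit shell
  `z ↦ a(|z|²)∇Y(z) − b(|z|²)Y(z) z` written with generic data (`M` = Hessian, `g = ∇Y(z)`, `A = a`, `A′ = a′`, `B = b`, `B′ = b′`, `Y = Y(z)`):
  `v ↦ A·Mv + 2A′⟪z,v⟫ g − BY v − (B⟪g,v⟫ + 2B′Y⟪z,v⟫) z`.  The pressure source is `σ = div((u₀·∇)u₀) = tr(Du₀ ∘ Du₀)`.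
* `sqForm Q = Q² − (tr Q²/3)·1` (traceless square, a quadratic form of `V₂` again), `quartic Q` = the degree-4 harmonic part of `Y_Q²`:
  `S₄ = Y_Q² − (4/7)|z|² S₂ − (2/15)(tr Q²)|z|⁴`, `S₂ = quadY (sqForm Q)`.  SOURCE STRUCTURE: `σ(x₀+z) = (tr Q²)·ã₀(s) + ã₂(s) S₂(z) + ã₄(s) S₄(z)`.
* the three source channels in `s`: `chanTwo h`, `chanFour h` (= g7's `aTwo H`, `aFour H` in model form, `ProfileHorn.aTwo_eq` / `aFour_eq`) and the
  monopole channel `chanZero h` (`ã₀ = 36h² + 96 s h h′ − (16/5)s²h′² + (96/5)s² h h″ − (64/5)s³ h′h″`, times `tr Q²`; never needed by g7's bracket,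
  needed here for the full Poisson equation).
* the generic radial layer of a channel `g`: `Gin L g s = ∫₀¹ t^{2L+2} g(s t²) dt` (so `r^{−2L−1}∫₀ʳρ^{2L+2}g(ρ²)dρ = r² Gin(r²)` — smooth at the apex),
  `Gout g s = ∫_(s,∞) g` (`= 2∫_(r,∞) ρ g(ρ²) dρ` at `s = r²`), and the decaying radial coefficient `radCoeff L g = (s·Gin + Gout/2)/(2L+1)` of the
  multipole solution `b_L″ + (2L+2)b_L′/r = −a_L` (so that `r b_L′ + L b_L = ProfileHorn.eulerPressure a_L L r`).
* `shellPressure Q h z = (tr Q²)·β₀(s) + β₂(s) S₂(z) + β₄(s) S₄(z)` — the explicit decaying pressure of the centred shell.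

WHAT THIS IS NOT: no NS-regularity statement is touched; `UnthreadedRigidity` (27585), W2 and NS regularity stay OPEN; these are the objects of the
L-part of ONE bridge of a RUNG line about SPECIAL (separable `l = 2`) slice data.  [cite: MajdaBertozziCUP2002, §1.1 (vector identities)]
-/

-- the summit and its single sub-problem share the name (CONVENTIONS §1)
set_option linter.dupNamespace false

namespace Summit.NavierStokesRegularity.NavierStokesRegularity.Theorems.UnthreadedRigidity.HornPressure

open scoped RealInnerProductSpace
open Summit.NavierStokesRegularity.NavierStokesRegularity.Theorems.UnthreadedRigidity.ProfileHorn (E3 quadY)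

/-! ## Linear algebra of the shell derivative -/

/-- the linear map of a `3 × 3` real matrix on `E3 = ℝ³`: `(matCLM M v) i = Σⱼ M i j · v j`. [folklore] -/
noncomputable def matCLM (M : Matrix (Fin 3) (Fin 3) ℝ) : E3 →L[ℝ] E3 :=
  ∑ j : Fin 3, (EuclideanSpace.proj j : E3 →L[ℝ] ℝ).smulRight (WithLp.toLp 2 fun i => M i j)

/-- the derivative of an explicit shell `z ↦ a(|z|²)∇Y(z) − b(|z|²)Y(z)·z`, written with generic data: Hessian matrix `M`, point `z`,
gradient value `g`, scalars `A = a(s)`, `A' = a′(s)`, `B = b(s)`, `B' = b′(s)`, `Y = Y(z)`: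
`v ↦ A·Mv + 2A′⟪z,v⟫·g − B·Y·v − (B⟪g,v⟫ + 2B′Y⟪z,v⟫)·z`. [folklore] -/
noncomputable def shellDeriv (M : Matrix (Fin 3) (Fin 3) ℝ) (z g : E3) (A A' B B' Y : ℝ) : E3 →L[ℝ] E3 :=
  A • matCLM M + ((2 * A') • innerSL ℝ z).smulRight g
    - ((B * Y) • ContinuousLinearMap.id ℝ E3 + (B • innerSL ℝ g + (2 * B' * Y) • innerSL ℝ z).smulRight z)

/-! ## The angular basis of the source: `S₂ = quadY (sqForm Q)`, `S₄ = quartic Q` -/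

/-- the traceless square of a form: `(Q²)₀ = Q·Q − (tr(Q·Q)/3)·1` (the `V₂`-component of `|∇Y_Q|² = 4 zᵀQ²z`). [folklore] -/
noncomputable def sqForm (Q : Matrix (Fin 3) (Fin 3) ℝ) : Matrix (Fin 3) (Fin 3) ℝ :=
  Q * Q - (Matrix.trace (Q * Q) / 3) • (1 : Matrix (Fin 3) (Fin 3) ℝ)

/-- the degree-four solid harmonic `S₄ = proj_{H₄}(Y_Q²) = Y_Q(z)² − (4/7)|z|²·S₂(z) − (2/15)·tr(Q²)·|z|⁴`. [folklore] -/
noncomputable def quartic (Q : Matrix (Fin 3) (Fin 3) ℝ) (z : E3) : ℝ :=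
  quadY Q z ^ 2 - 4 / 7 * ‖z‖ ^ 2 * quadY (sqForm Q) z - 2 / 15 * Matrix.trace (Q * Q) * (‖z‖ ^ 2) ^ 2

/-! ## The three source channels in the variable `s = r²` -/

/-- quadrupole channel `ã₂(s) = (24/7)(4s h′² + 42 h h′ + 12 s h h″ − 8 s² h′h″)` (`= ProfileHorn.aTwo H √s`, `ProfileHorn.aTwo_eq`). [folklore] -/
noncomputable def chanTwo (h : ℝ → ℝ) (s : ℝ) : ℝ :=
  24 / 7 * (4 * s * deriv h s ^ 2 + 42 * h s * deriv h s + 12 * s * h s * deriv (deriv h) s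
    - 8 * s ^ 2 * deriv h s * deriv (deriv h) s)

/-- hexadecapole channel `ã₄(s) = 8(52 h′² − 12 h h″ + 8 s h′h″)` (`= ProfileHorn.aFour H √s`, `ProfileHorn.aFour_eq`). [folklore] -/
noncomputable def chanFour (h : ℝ → ℝ) (s : ℝ) : ℝ :=
  8 * (52 * deriv h s ^ 2 - 12 * h s * deriv (deriv h) s + 8 * s * deriv h s * deriv (deriv h) s)

/-- monopole channel (per unit `tr Q²`): `ã₀(s) = 36h² + 96 s h h′ − (16/5)s²h′² + (96/5)s² h h″ − (64/5)s³ h′h″` (the radial part of the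
source; absent from g7's bracket because `{Y_Q, ·}` kills radial functions, present in the Poisson equation). [folklore] -/
noncomputable def chanZero (h : ℝ → ℝ) (s : ℝ) : ℝ :=
  36 * h s ^ 2 + 96 * s * h s * deriv h s - 16 / 5 * s ^ 2 * deriv h s ^ 2
    + 96 / 5 * s ^ 2 * h s * deriv (deriv h) s - 64 / 5 * s ^ 3 * deriv h s * deriv (deriv h) s

/-! ## The radial layer of a channel `g` (multipole of degree `L`) -/

/-- scaled inner moment `Gin L g s = ∫₀¹ t^{2L+2} g(s t²) dt`; at `s = r²`: `r^{−(2L+1)} ∫₀ʳ ρ^{2L+2} g(ρ²) dρ = r²·Gin L g (r²)` — this form is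
manifestly smooth in `s` across the apex `s = 0`. [folklore] -/
noncomputable def Gin (L : ℕ) (g : ℝ → ℝ) (s : ℝ) : ℝ :=
  ∫ t in (0 : ℝ)..1, t ^ (2 * L + 2) * g (s * t ^ 2)

/-- outer moment `Gout g s = ∫_(s,∞) g(σ) dσ`; at `s = r²`: `2 ∫_(r,∞) ρ g(ρ²) dρ = 2·ProfileHorn.outerMoment`. [folklore] -/
noncomputable def Gout (g : ℝ → ℝ) (s : ℝ) : ℝ :=
  ∫ σ in Set.Ioi s, g σ

/-- the decaying radial coefficient of the degree-`L` multipole: `β_L(s) = (s·Gin L g s + Gout g s/2)/(2L+1)`, i.e. at `s = r²` the regular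
decaying solution `b_L(r) = (r^{−2L−1} I_L(r) + J_L(r))/(2L+1)` of `b″ + (2L+2) b′/r = −a_L` (Newtonian potential of `a_L S_L`); its Euler
derivative `r b′ + L b` is `ProfileHorn.eulerPressure a_L L r`. [folklore] -/
noncomputable def radCoeff (L : ℕ) (g : ℝ → ℝ) (s : ℝ) : ℝ :=
  (s * Gin L g s + Gout g s / 2) / (2 * L + 1)

/-! ## The explicit pressure of the centred `l = 2` shell -/

/-- THE EXPLICIT (MULTIPOLE / NEWTONIAN) PRESSURE of the centred shell `z ↦ curl curl (h(|z|²) Y_Q(z) z)`: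
`p*(z) = tr(Q²)·β₀(|z|²) + β₂(|z|²)·S₂(z) + β₄(|z|²)·S₄(z)`, `β_L = radCoeff L ã_L`.  It is smooth on `E3`, solves `Δp* = −σ`, tends to `0` at
infinity, and therefore IS the decaying slice pressure `p₀(x₀ + ·)` (Liouville, `ThreadingJets.slicePressure_eq_of_decaying`). [folklore] -/
noncomputable def shellPressure (Q : Matrix (Fin 3) (Fin 3) ℝ) (h : ℝ → ℝ) (z : E3) : ℝ :=
  Matrix.trace (Q * Q) * radCoeff 0 (chanZero h) (‖z‖ ^ 2)
    + radCoeff 2 (chanTwo h) (‖z‖ ^ 2) * quadY (sqForm Q) z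
    + radCoeff 4 (chanFour h) (‖z‖ ^ 2) * quartic Q z

end Summit.NavierStokesRegularity.NavierStokesRegularity.Theorems.UnthreadedRigidity.HornPressure
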